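import Summits.Ventures.PercRepro.C041PortProblemDefs

/-!
# The port problem of THEOREM R: CASE (ii) — a switchable gate of type `{1, 2}` (p6, gen 23)

Setting of `C041PortProblemDefs` (mine-3's LEAN SHEET, C-041.md §6).  CASE (ii) of the LEMMA: if some gate `p` is
switchable and carries both a 1-edge and a 2-edge, then `Φ∨ P ≥ 0` and `Φ∧ P ≥ 0` — by a 2-to-1 charging instead of
the paper's grouping: the admissible valid patterns split into those with both edges at `p` red (weight `4`: both
sides are Good by the KEY FACT), those with the 1-edge blue and those with the 2-edge blue (weight `≥ −2` each); reddening
the blue edge at `p` injects each of the last two classes into the first (`Function.update` is injective on patterns that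
agree at the updated edge; admissibility and validity only improve), so `Φ ≥ 4·#RR − 2·#B₁ − 2·#B₂ ≥ 0`.

* `weight_eq_four_of_red_gate` — both edges at a switchable two-type gate red ⟹ `Good₁ ∧ Good₂`, weight `4`;
* `neg_two_le_weight`;
* `phi_nonneg_of_twoType_gate` — the case for any validity predicate monotone under reddening;
* `phiOr_nonneg_of_twoType_gate`, `phiAnd_nonneg_of_twoType_gate`.
-/

namespace PercRepro

namespace PortProblem

namespace Problem

open Finset

variable {V : Type*} {P : Problem V}

/-- The weight is at least `−2`. -/
theorem neg_two_le_weight (x : P.Term → Bool) : -2 ≤ P.weight x := by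
  unfold weight
  split_ifs <;> omega

/-- A port is in `A₁ x` iff its 1-edge is blue (the terminal edge is determined by its name). -/
theorem mem_A₁_iff {x : P.Term → Bool} {e : P.Term} (he : e.1.2 = false) :
    e.1.1 ∈ P.A₁ x ↔ x e = false := by
  constructor
  · rintro ⟨f, hf, hxf⟩
    have h1 : e.1 = (e.1.1, false) := Prod.ext_iff.mpr ⟨rfl, he⟩
    have : f = e := by
      apply Subtype.ext
      rw [hf, h1]
    rw [← this]
    exact hxf
  · intro hxe
    have h1 : e.1 = (e.1.1, false) := Prod.ext_iff.mpr ⟨rfl, he⟩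
    exact ⟨e, h1, hxe⟩

/-- A port is in `A₂ x` iff its 2-edge is blue. -/
theorem mem_A₂_iff {x : P.Term → Bool} {e : P.Term} (he : e.1.2 = true) :
    e.1.1 ∈ P.A₂ x ↔ x e = false := by
  constructor
  · rintro ⟨f, hf, hxf⟩
    have h1 : e.1 = (e.1.1, true) := Prod.ext_iff.mpr ⟨rfl, he⟩
    have : f = e := by
      apply Subtype.ext
      rw [hf, h1]
    rw [← this]
    exact hxf
  · intro hxe
    have h1 : e.1 = (e.1.1, true) := Prod.ext_iff.mpr ⟨rfl, he⟩
    exact ⟨e, h1, hxe⟩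

/-- **Both edges red at a gate**: `Good₁` and `Good₂` hold (the KEY FACT on both sides). -/
theorem good_both_of_red_gate {x : P.Term → Bool} {e₁ e₂ : P.Term} (hp : P.IsGate e₁.1.1)
    (h12 : e₁.1.1 = e₂.1.1) (he₁ : e₁.1.2 = false) (he₂ : e₂.1.2 = true)
    (hx₁ : x e₁ = true) (hx₂ : x e₂ = true) : P.Good₁ x ∧ P.Good₂ x := by
  constructor
  · refine ⟨e₂, he₂, hx₂, ?_⟩
    rw [← h12]
    refine reach_gate (A₁_subset x) hp ?_
    rw [mem_A₁_iff he₁, hx₁]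
    exact Bool.noConfusion
  · refine ⟨e₁, he₁, hx₁, ?_⟩
    refine reach_gate (A₂_subset x) hp ?_
    rw [h12, mem_A₂_iff he₂, hx₂]
    exact Bool.noConfusion

open Classical in
/-- **Both edges red at a gate**: the weight is `4`. -/
theorem weight_eq_four_of_red_gate {x : P.Term → Bool} {e₁ e₂ : P.Term} (hp : P.IsGate e₁.1.1)
    (h12 : e₁.1.1 = e₂.1.1) (he₁ : e₁.1.2 = false) (he₂ : e₂.1.2 = true)
    (hx₁ : x e₁ = true) (hx₂ : x e₂ = true) : P.weight x = 4 := by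
  obtain ⟨h1, h2⟩ := good_both_of_red_gate hp h12 he₁ he₂ hx₁ hx₂
  unfold weight
  rw [if_pos h1, if_pos h2]
  norm_num

section Update

variable [DecidableEq V]

/-- Reddening one edge keeps admissibility. -/
theorem adm_update_true {x : P.Term → Bool} (hx : P.Adm x) (e : P.Term) :
    P.Adm (Function.update x e true) := by
  refine ⟨fun f hf => ?_, fun f g hfg hf hg => ?_⟩
  · by_cases hfe : f = e
    · rw [hfe, Function.update_self]
    · rw [Function.update_of_ne hfe]
      exact hx.1 f hf
  · rcases hx.2 f g hfg hf hg with h | h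
    · left
      by_cases hfe : f = e
      · rw [hfe, Function.update_self]
      · rw [Function.update_of_ne hfe]
        exact h
    · right
      by_cases hge : g = e
      · rw [hge, Function.update_self]
      · rw [Function.update_of_ne hge]
        exact h

/-- Reddening one edge keeps `X₁`. -/
theorem X₁_update_true {x : P.Term → Bool} (hx : P.X₁ x) (e : P.Term) :
    P.X₁ (Function.update x e true) := by
  obtain ⟨f, hf, hxf⟩ := hx
  refine ⟨f, hf, ?_⟩
  by_cases hfe : f = e
  · rw [hfe, Function.update_self]
  · rw [Function.update_of_ne hfe]
    exact hxf

/-- Reddening one edge keeps `X₂`. -/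
theorem X₂_update_true {x : P.Term → Bool} (hx : P.X₂ x) (e : P.Term) :
    P.X₂ (Function.update x e true) := by
  obtain ⟨f, hf, hxf⟩ := hx
  refine ⟨f, hf, ?_⟩
  by_cases hfe : f = e
  · rw [hfe, Function.update_self]
  · rw [Function.update_of_ne hfe]
    exact hxf

/-- `Function.update` at `e` is injective on the functions with a common value at `e`. -/
theorem update_injOn {α β : Type*} [DecidableEq α] (e : α) (b v : β) :
    Set.InjOn (fun x : α → β => Function.update x e b) {x | x e = v} := by
  intro x hx y hy hxy
  funext f
  by_cases hfe : f = e
  · rw [hfe]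
    exact hx.trans hy.symm
  · have := congrFun hxy f
    simp only [Function.update_of_ne hfe] at this
    exact this

end Update

section Sums

variable [Fintype V] [DecidableEq V]

open Classical in
/-- **CASE (ii), general form**: for a validity predicate `val` kept by reddening, a switchable gate carrying both
terminal edges gives `0 ≤ Σ_{x admissible, val x} weight x`. -/
theorem phi_nonneg_of_twoType_gate (val : (P.Term → Bool) → Prop)
    (hval : ∀ x e, val x → val (Function.update x e true))
    {e₁ e₂ : P.Term} (hp : P.IsGate e₁.1.1) (h12 : e₁.1.1 = e₂.1.1)
    (he₁ : e₁.1.2 = false) (he₂ : e₂.1.2 = true) :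
    0 ≤ ∑ x : P.Term → Bool, if P.Adm x ∧ val x then P.weight x else 0 := by
  have hne : e₁ ≠ e₂ := by
    intro h
    rw [h] at he₁
    rw [he₁] at he₂
    exact Bool.noConfusion he₂
  -- the three classes
  set RR := (univ : Finset (P.Term → Bool)).filter fun x => (P.Adm x ∧ val x) ∧
    (x e₁ = true ∧ x e₂ = true) with hRR
  set B₁ := (univ : Finset (P.Term → Bool)).filter fun x => (P.Adm x ∧ val x) ∧ x e₁ = false with hB₁
  set B₂ := (univ : Finset (P.Term → Bool)).filter fun x => (P.Adm x ∧ val x) ∧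
    (x e₁ = true ∧ x e₂ = false) with hB₂
  -- the sum over the admissible valid patterns, split
  set S := (univ : Finset (P.Term → Bool)).filter fun x => P.Adm x ∧ val x with hS
  have hRR' : S.filter (fun x => x e₁ = true ∧ x e₂ = true) = RR := by
    rw [hS, hRR, filter_filter]
  have hB₁' : (S.filter fun x => ¬ (x e₁ = true ∧ x e₂ = true)).filter (fun x => x e₁ = false) = B₁ := by
    rw [hS, hB₁, filter_filter, filter_filter]
    ext x
    simp only [mem_filter, mem_univ, true_and]
    cases h1 : x e₁ <;> cases h2 : x e₂ <;> simp
  have hB₂' : (S.filter fun x => ¬ (x e₁ = true ∧ x e₂ = true)).filter (fun x => ¬ x e₁ = false) = B₂ := by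
    rw [hS, hB₂, filter_filter, filter_filter]
    ext x
    simp only [mem_filter, mem_univ, true_and]
    cases h1 : x e₁ <;> cases h2 : x e₂ <;> simp
  have hsplit : (∑ x : P.Term → Bool, if P.Adm x ∧ val x then P.weight x else 0) =
      ∑ x ∈ RR, P.weight x + ∑ x ∈ B₁, P.weight x + ∑ x ∈ B₂, P.weight x := by
    rw [← Finset.sum_filter, ← hS, ← Finset.sum_filter_add_sum_filter_not S
      (fun x => x e₁ = true ∧ x e₂ = true), hRR', ← Finset.sum_filter_add_sum_filter_not
      (S.filter fun x => ¬ (x e₁ = true ∧ x e₂ = true)) (fun x => x e₁ = false), hB₁', hB₂', add_assoc]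
  -- the weights on the classes
  have hRRw : ∑ x ∈ RR, P.weight x = 4 * (RR.card : ℤ) := by
    have h4 : ∀ x ∈ RR, P.weight x = 4 := by
      intro x hx
      rw [hRR, mem_filter] at hx
      exact weight_eq_four_of_red_gate hp h12 he₁ he₂ hx.2.2.1 hx.2.2.2
    rw [Finset.sum_congr rfl h4, Finset.sum_const, nsmul_eq_mul, mul_comm]
  have hB₁w : -2 * (B₁.card : ℤ) ≤ ∑ x ∈ B₁, P.weight x := by
    calc -2 * (B₁.card : ℤ) = ∑ _x ∈ B₁, (-2 : ℤ) := by rw [Finset.sum_const, nsmul_eq_mul, mul_comm]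
      _ ≤ ∑ x ∈ B₁, P.weight x := Finset.sum_le_sum fun x _ => neg_two_le_weight x
  have hB₂w : -2 * (B₂.card : ℤ) ≤ ∑ x ∈ B₂, P.weight x := by
    calc -2 * (B₂.card : ℤ) = ∑ _x ∈ B₂, (-2 : ℤ) := by rw [Finset.sum_const, nsmul_eq_mul, mul_comm]
      _ ≤ ∑ x ∈ B₂, P.weight x := Finset.sum_le_sum fun x _ => neg_two_le_weight x
  -- the injections into `RR`
  have hB₁c : B₁.card ≤ RR.card := by
    refine card_le_card_of_injOn (fun x => Function.update x e₁ true) ?_ ?_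
    · intro x hx
      rw [hB₁, coe_filter] at hx
      rw [hRR, coe_filter]
      have hx2 : x e₂ = true := by
        rcases hx.2.1.1.2 e₁ e₂ h12 he₁ he₂ with h | h
        · rw [hx.2.2] at h
          exact Bool.noConfusion h
        · exact h
      refine ⟨mem_univ _, ⟨adm_update_true hx.2.1.1 e₁, hval x e₁ hx.2.1.2⟩, ?_, ?_⟩
      · show Function.update x e₁ true e₁ = true
        exact Function.update_self ..
      · show Function.update x e₁ true e₂ = true
        rw [Function.update_of_ne hne.symm]
        exact hx2
    · intro x hx y hy hxy
      rw [hB₁, coe_filter] at hx hy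
      exact update_injOn e₁ true false hx.2.2 hy.2.2 hxy
  have hB₂c : B₂.card ≤ RR.card := by
    refine card_le_card_of_injOn (fun x => Function.update x e₂ true) ?_ ?_
    · intro x hx
      rw [hB₂, coe_filter] at hx
      rw [hRR, coe_filter]
      refine ⟨mem_univ _, ⟨adm_update_true hx.2.1.1 e₂, hval x e₂ hx.2.1.2⟩, ?_, ?_⟩
      · show Function.update x e₂ true e₁ = true
        rw [Function.update_of_ne hne]
        exact hx.2.2.1
      · show Function.update x e₂ true e₂ = true
        exact Function.update_self ..
    · intro x hx y hy hxy
      rw [hB₂, coe_filter] at hx hy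
      exact update_injOn e₂ true false hx.2.2.2 hy.2.2.2 hxy
  rw [hsplit, hRRw]
  have h1 : (B₁.card : ℤ) ≤ RR.card := by exact_mod_cast hB₁c
  have h2 : (B₂.card : ℤ) ≤ RR.card := by exact_mod_cast hB₂c
  linarith

open Classical in
/-- **CASE (ii) of the LEMMA, `Φ∨`**: a switchable gate carrying a 1-edge and a 2-edge gives `0 ≤ Φ∨ P`. -/
theorem phiOr_nonneg_of_twoType_gate {p : V} (hp : P.IsGate p) (hsw : P.sw p = true)
    (hk₁ : P.k₁ p = true) (hk₂ : P.k₂ p = true) : 0 ≤ P.phiOr := by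
  let e₁ : P.Term := ⟨(p, false), hp.mem, fun _ => hk₁, fun h => Bool.noConfusion h⟩
  let e₂ : P.Term := ⟨(p, true), hp.mem, fun h => Bool.noConfusion h, fun _ => hk₂⟩
  have _ := hsw
  unfold phiOr
  convert phi_nonneg_of_twoType_gate (fun x => P.X₁ x ∨ P.X₂ x)
    (fun x e h => h.elim (fun h' => Or.inl (X₁_update_true h' e)) (fun h' => Or.inr (X₂_update_true h' e)))
    (e₁ := e₁) (e₂ := e₂) hp rfl rfl rfl using 3

open Classical in
/-- **CASE (ii) of the LEMMA, `Φ∧`**: a switchable gate carrying a 1-edge and a 2-edge gives `0 ≤ Φ∧ P`. -/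
theorem phiAnd_nonneg_of_twoType_gate {p : V} (hp : P.IsGate p) (hsw : P.sw p = true)
    (hk₁ : P.k₁ p = true) (hk₂ : P.k₂ p = true) : 0 ≤ P.phiAnd := by
  let e₁ : P.Term := ⟨(p, false), hp.mem, fun _ => hk₁, fun h => Bool.noConfusion h⟩
  let e₂ : P.Term := ⟨(p, true), hp.mem, fun h => Bool.noConfusion h, fun _ => hk₂⟩
  have _ := hsw
  unfold phiAnd
  convert phi_nonneg_of_twoType_gate (fun x => P.X₁ x ∧ P.X₂ x)
    (fun x e h => ⟨X₁_update_true h.1 e, X₂_update_true h.2 e⟩)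
    (e₁ := e₁) (e₂ := e₂) hp rfl rfl rfl using 3

end Sums

end Problem

end PortProblem

end PercRepro
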